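import Summits.AtomisticToContinuum.BoseEinsteinCondensation.Theorems.BECThomsonPrincipleFibreConductanceHealingDefs
import Literature.MathematicalPhysics.QuantumManyBody.PeriodicBoseGasUpperBoundProofs
import Literature.MathematicalPhysics.QuantumManyBody.BoseGasThermodynamicLimitRuelle
import HarnessLib

/-!
# Route `BECThomsonPrinciple`, crux `FibreConductance` (stmt-AtomisticToContinuum-9480),
# line `healing-split-kinetic-defect` — stub `stub_kineticBudget`: THE KINETIC BUDGET

`stub_kineticBudget : KineticBudgetExists` — for every repulsive finite-range `v` there are
`C_F ≥ 0`, `ρ_F > 0`, `N_F` such that every exact zero-free minimiser `Φ` of the periodic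
`N = m + 1`-body energy at density `ρ̄ = N/L³ ≤ ρ_F`, `N ≥ N_F`, has kinetic energy
`T(Φ) ≤ C_F ρ̄ a N` and fibre Fisher information `∫_{cellN} W|∇₀ψ|² ≤ C_F ρ̄ a`
(`a` = scattering length, `W` = bath weight, `ψ = |Φ|/√W` the conditional amplitude).

* `kb_fibreW_mul_dPsi_sq_le` — the DIAMAGNETIC step, pointwise: `W (∂_{0,l}ψ)² ≤ |∂_{0,l}Φ|²`.
  Along the line `t ↦ X + t e_{0,l}` the bath weight is constant (`fibreW_update`), so
  differentiating `|Φ|² = Wψ²` gives `Wψ ∂ψ = ⟨Φ, ∂Φ⟩_ℝ`, and Cauchy–Schwarz with `|Φ|² = Wψ²`;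
* `kb_succ_mul_lintegral_gradSq_zero` — BOSE SYMMETRY: `N ∫_{cellN} |∇₀Φ|² = T(Φ)` (the tree's
  `gradSqAt_eq_zero_comp_swap` + `lintegral_cellN_comp_perm`), whence `N · fibreFisher Φ ≤ T(Φ)`;
* `kb_exists_energy_budget` — DYSON'S BOUND in the dilute window: from the proved
  `LSSY2005_upperBound_periodic_holds` (`E₀ ≤ 4πρ₁a(1 + C a/b)N` for `N ≥ 2`, `2R₀ < L`, `a/b ≤ c`),
  with `N_F = 2` and `ρ_F = min(1/(8R³), 3(c/(a+1))³/(4π))`, `R = max(R₀, 1)`, so that `L > 2R` and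
  `a/b = a(4πρ₁/3)^{1/3} ≤ a·c/(a+1) ≤ c`; then `E₀ ≤ 4π(1 + Cc)·ρ̄ a N`, `C_F = 4π(1 + Cc)`;
* `stub_kineticBudget` — `T ≤ periodicEnergy v Φ = E₀` ((H1)) and the three items above.

References: the line card `Cruxes/FibreConductance/Lines/healing-split-kinetic-defect.md`; LSSY2005
Thm. 2.2 (2.14) (Dyson's upper bound; used only through the tree's proved
`LSSY2005_upperBound_periodic_holds`).
-/

noncomputable section

namespace Summit.AtomisticToContinuum.BoseEinsteinCondensation.Cruxes.FibreConductance.HealingSplitKineticDefect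

open MeasureTheory
open scoped ENNReal RealInnerProductSpace
open Literature.MathematicalPhysics.QuantumManyBody.BoseGas
open Summit.AtomisticToContinuum.BoseEinsteinCondensation.Cruxes.FibreConductance.ParsevalShellBootstrap

variable {m : ℕ} {L : ℝ}

/-! ### The diamagnetic step `W|∇₀ψ|² ≤ |∇₀Φ|²` -/

/-- The bath weight is constant along the lines `t ↦ X + t e_{0,l}` of the fibre. [folklore] -/
theorem kb_fibreW_add_smul_e0 (Φ : PeriodicTrialState (m + 1) L) (X : Config (m + 1)) (l : Fin 3)
    (t : ℝ) : fibreW Φ (X + t • e0 m l) = fibreW Φ X := by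
  have h : X + t • e0 m l = Function.update X 0 (X 0 + t • EuclideanSpace.single l (1 : ℝ)) := by
    rw [update_zero_add, Function.update_eq_self, e0, Pi.single_smul]
  rw [h, fibreW_update]

/-- **Diamagnetic inequality in the fibre**, pointwise: `W(X) (∂_{0,l}ψ(X))² ≤ |∂_{0,l}Φ(X)|²` for a
zero-free state (`L > 0`). Differentiating `|Φ|² = Wψ²` along `t ↦ X + t e_{0,l}` (where `W` is
constant) gives `Wψ∂ψ = ⟨Φ, ∂Φ⟩_ℝ`; then Cauchy–Schwarz and `|Φ|² = Wψ²`. [folklore] -/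
theorem kb_fibreW_mul_dPsi_sq_le (hL : 0 < L) (Φ : PeriodicTrialState (m + 1) L)
    (hΦ : ∀ X, Φ.ψ X ≠ 0) (X : Config (m + 1)) (l : Fin 3) :
    fibreW Φ X * dPsi Φ X l ^ 2 ≤ ‖fderiv ℝ Φ.ψ X (e0 m l)‖ ^ 2 := by
  have hW := fibreW_pos hL Φ hΦ X
  have hψ := fibrePsi_pos hL Φ hΦ X
  -- the two line derivatives of `t ↦ |Φ(X + t e)|² = W(X) ψ(X + t e)²` at `t = 0`
  have hΦl : HasDerivAt (fun t : ℝ => Φ.ψ (X + t • e0 m l)) (fderiv ℝ Φ.ψ X (e0 m l)) 0 :=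
    ((Φ.contDiff.differentiable one_ne_zero) X).hasFDerivAt.hasLineDerivAt (e0 m l)
  have hψl : HasDerivAt (fun t : ℝ => fibrePsi Φ (X + t • e0 m l)) (dPsi Φ X l) 0 :=
    ((contDiff_fibrePsi hL Φ hΦ).differentiable one_ne_zero X).hasFDerivAt.hasLineDerivAt (e0 m l)
  have h1 := hΦl.norm_sq
  have h2 : HasDerivAt (fun t : ℝ => ‖Φ.ψ (X + t • e0 m l)‖ ^ 2)
      (2 * (fibreW Φ X * fibrePsi Φ X * dPsi Φ X l)) 0 := by
    have hfun : (fun t : ℝ => ‖Φ.ψ (X + t • e0 m l)‖ ^ 2) =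
        fun t => fibreW Φ X * fibrePsi Φ (X + t • e0 m l) ^ 2 := by
      funext t
      rw [norm_sq_eq_fibreW_mul_sq hL Φ hΦ, kb_fibreW_add_smul_e0]
    rw [hfun]
    refine ((hψl.fun_pow 2).const_mul (fibreW Φ X)).congr_deriv ?_
    simp only [zero_smul, add_zero, Nat.cast_ofNat, Nat.reduceSub, pow_one]
    ring
  have h3 : fibreW Φ X * fibrePsi Φ X * dPsi Φ X l = ⟪Φ.ψ X, fderiv ℝ Φ.ψ X (e0 m l)⟫ := by
    have h := h2.unique h1
    simp only [zero_smul, add_zero] at h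
    linarith
  -- Cauchy–Schwarz: `(Wψ∂ψ)² ≤ |Φ|²|∂Φ|² = Wψ²|∂Φ|²`, then cancel `Wψ² > 0`
  have hcs : (fibreW Φ X * fibrePsi Φ X * dPsi Φ X l) ^ 2 ≤
      fibreW Φ X * fibrePsi Φ X ^ 2 * ‖fderiv ℝ Φ.ψ X (e0 m l)‖ ^ 2 := by
    rw [h3, ← norm_sq_eq_fibreW_mul_sq hL Φ hΦ X, ← mul_pow, ← sq_abs]
    exact pow_le_pow_left₀ (abs_nonneg _) (abs_real_inner_le_norm _ _) 2
  refine le_of_mul_le_mul_left ?_ (mul_pos hW (pow_pos hψ 2))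
  calc fibreW Φ X * fibrePsi Φ X ^ 2 * (fibreW Φ X * dPsi Φ X l ^ 2)
      = (fibreW Φ X * fibrePsi Φ X * dPsi Φ X l) ^ 2 := by ring
    _ ≤ fibreW Φ X * fibrePsi Φ X ^ 2 * ‖fderiv ℝ Φ.ψ X (e0 m l)‖ ^ 2 := hcs

/-- The diamagnetic step summed over the axes, in `ℝ≥0∞`: `W Σ_l (∂_{0,l}ψ)² ≤ |∇₀Φ|²` (the
particle-`0` summand of `kineticDensity`). [folklore] -/
theorem kb_ofReal_fibreW_mul_sum_le (hL : 0 < L) (Φ : PeriodicTrialState (m + 1) L)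
    (hΦ : ∀ X, Φ.ψ X ≠ 0) (X : Config (m + 1)) :
    ENNReal.ofReal (fibreW Φ X * ∑ l : Fin 3, dPsi Φ X l ^ 2) ≤
      ∑ k : Fin 3,
        (‖fderiv ℝ Φ.ψ X (Pi.single 0 (EuclideanSpace.single k (1 : ℝ)))‖₊ : ℝ≥0∞) ^ 2 := by
  rw [Finset.mul_sum, ENNReal.ofReal_sum_of_nonneg fun l _ =>
    mul_nonneg (fibreW_nonneg Φ X) (sq_nonneg _)]
  refine Finset.sum_le_sum fun l _ => ?_
  rw [coe_nnnorm_sq_eq_ofReal]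
  exact ENNReal.ofReal_le_ofReal (kb_fibreW_mul_dPsi_sq_le hL Φ hΦ X l)

/-! ### Bose symmetry: `N ∫|∇₀Φ|² = T(Φ)` and `N · fibreFisher ≤ T` -/

/-- **Bose symmetry of the kinetic energy**: `N ∫_{cellN} |∇₀Φ|² = ∫_{cellN} |∇Φ|² = T(Φ)` (each
particle's kinetic term equals particle `0`'s after the measure-preserving relabelling
`X ↦ X ∘ (0 i)` of the cell). [folklore] -/
theorem kb_succ_mul_lintegral_gradSq_zero (Φ : PeriodicTrialState (m + 1) L) :
    ((m + 1 : ℕ) : ℝ≥0∞) * ∫⁻ X in cellN (m + 1) L, ∑ k : Fin 3,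
        (‖fderiv ℝ Φ.ψ X (Pi.single 0 (EuclideanSpace.single k (1 : ℝ)))‖₊ : ℝ≥0∞) ^ 2 =
      ∫⁻ X in cellN (m + 1) L, kineticDensity Φ.ψ X := by
  have hdiff : Differentiable ℝ Φ.ψ := Φ.contDiff.differentiable one_ne_zero
  simp only [kineticDensity_eq_sum_gradSqAt]
  rw [lintegral_finsetSum _ fun i _ => measurable_gradSqAt i Φ.ψ]
  have hi : ∀ i : Fin (m + 1), (∫⁻ X in cellN (m + 1) L, ∑ k : Fin 3,
      (‖fderiv ℝ Φ.ψ X (Pi.single i (EuclideanSpace.single k (1 : ℝ)))‖₊ : ℝ≥0∞) ^ 2) =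
      ∫⁻ X in cellN (m + 1) L, ∑ k : Fin 3,
        (‖fderiv ℝ Φ.ψ X (Pi.single 0 (EuclideanSpace.single k (1 : ℝ)))‖₊ : ℝ≥0∞) ^ 2 :=
    fun i => by
    rw [← lintegral_cellN_comp_perm (Equiv.swap 0 i) fun X => ∑ k : Fin 3,
      (‖fderiv ℝ Φ.ψ X (Pi.single 0 (EuclideanSpace.single k (1 : ℝ)))‖₊ : ℝ≥0∞) ^ 2]
    exact lintegral_congr fun X => gradSqAt_eq_zero_comp_swap hdiff Φ.symm i X
  simp only [hi, Finset.sum_const, Finset.card_univ, Fintype.card_fin, nsmul_eq_mul]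

/-- **Fibre Fisher information against the kinetic energy**: `N · ∫_{cellN} W|∇₀ψ|² ≤ T(Φ)`
(diamagnetic step + Bose symmetry). [folklore] -/
theorem kb_succ_mul_fibreFisher_le (hL : 0 < L) (Φ : PeriodicTrialState (m + 1) L)
    (hΦ : ∀ X, Φ.ψ X ≠ 0) :
    ((m + 1 : ℕ) : ℝ≥0∞) * fibreFisher Φ ≤ ∫⁻ X in cellN (m + 1) L, kineticDensity Φ.ψ X := by
  rw [← kb_succ_mul_lintegral_gradSq_zero Φ]
  unfold fibreFisher
  gcongr
  exact kb_ofReal_fibreW_mul_sum_le hL Φ hΦ _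

/-! ### Dyson's bound in the dilute window -/

/-- **The ground-state energy budget in the dilute window** (from the tree's proved Dyson–LSSY upper
bound `LSSY2005_upperBound_periodic_holds`): for repulsive finite-range `v` there are `C_F ≥ 0`,
`ρ_F > 0` with `E₀(N, L) ≤ C_F ρ̄ a N` whenever `N ≥ 2` and `ρ̄ = N/L³ ≤ ρ_F` (`R = max(R₀,1)`,
`ρ_F = min(1/(8R³), 3(c/(a+1))³/(4π))` forces `L > 2R` and `a/b ≤ c`; `C_F = 4π(1 + Cc)`).
[folklore] -/
theorem kb_exists_energy_budget (v : ℝ → ℝ≥0∞) (hv : IsRepulsiveFiniteRange v) :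
    ∃ C_F ρ_F : ℝ, 0 ≤ C_F ∧ 0 < ρ_F ∧ ∀ m : ℕ, 2 ≤ m + 1 → ∀ L : ℝ, 0 < L →
      ((m + 1 : ℕ) : ℝ) ≤ ρ_F * L ^ 3 →
        periodicGroundStateEnergy v (m + 1) L ≤ ENNReal.ofReal
          (C_F * (((m + 1 : ℕ) : ℝ) / L ^ 3) * (scatteringLength v).toReal * (m + 1 : ℕ)) := by
  obtain ⟨hmeas, R₀, hR₀⟩ := hv
  set R : ℝ := max R₀ 1 with hR
  have hRpos : 0 < R := lt_max_of_lt_right one_pos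
  have hvR : ∀ r, R < r → v r = 0 := fun r hr => hR₀ r ((le_max_left _ _).trans_lt hr)
  obtain ⟨C, c, hC, hc, H⟩ := LSSY2005_upperBound_periodic_holds v R hmeas hvR
    (IsRepulsiveFiniteRange.scatteringLength_ne_top ⟨hmeas, R₀, hR₀⟩)
  have ha0 : 0 ≤ (scatteringLength v).toReal := ENNReal.toReal_nonneg
  set q : ℝ := c / ((scatteringLength v).toReal + 1) with hq
  have hq0 : 0 < q := by positivity
  set ρ_F : ℝ := min (1 / (8 * R ^ 3)) (3 * q ^ 3 / (4 * Real.pi)) with hρF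
  have hρF0 : 0 < ρ_F := lt_min (by positivity) (by positivity)
  refine ⟨4 * Real.pi * (1 + C * c), ρ_F, by positivity, hρF0, fun m hm L hL hρ => ?_⟩
  -- (i) `2R < L`, from `2 ≤ N ≤ ρ_F L³ ≤ L³/(8R³)`
  have h2R : 2 * R < L := by
    have h2 : (2 : ℝ) ≤ ((m + 1 : ℕ) : ℝ) := by exact_mod_cast hm
    have h3 : ρ_F * L ^ 3 ≤ 1 / (8 * R ^ 3) * L ^ 3 :=
      mul_le_mul_of_nonneg_right (min_le_left _ _) (by positivity)
    have h4 : 2 ≤ 1 / (8 * R ^ 3) * L ^ 3 := h2.trans (hρ.trans h3)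
    rw [one_div_mul_eq_div, le_div_iff₀ (by positivity)] at h4
    by_contra h
    have h5 : L ^ 3 ≤ (2 * R) ^ 3 := pow_le_pow_left₀ hL.le (not_lt.1 h) 3
    nlinarith [pow_pos hRpos 3]
  have hU := H (m + 1) L hm hL h2R
  simp only at hU
  set a : ℝ := (scatteringLength v).toReal with ha
  set ρe : ℝ := (((m + 1 : ℕ) : ℝ) - 1) / L ^ 3 with hρe
  -- (ii) `a/b = a(4πρ₁/3)^{1/3} ≤ a·q ≤ c`
  have h1N : (1 : ℝ) ≤ ((m + 1 : ℕ) : ℝ) := by exact_mod_cast Nat.succ_pos m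
  have hρe0 : 0 ≤ ρe := div_nonneg (by linarith) (by positivity)
  have hρe_le : ρe ≤ ((m + 1 : ℕ) : ℝ) / L ^ 3 :=
    div_le_div_of_nonneg_right (by linarith) (by positivity)
  have hρ_le : ((m + 1 : ℕ) : ℝ) / L ^ 3 ≤ ρ_F := by rw [div_le_iff₀ (by positivity)]; exact hρ
  have hx0 : 0 ≤ 4 * Real.pi * ρe / 3 := by positivity
  have hab_eq : a / (4 * Real.pi * ρe / 3) ^ (-(1 : ℝ) / 3) =
      a * (4 * Real.pi * ρe / 3) ^ ((1 : ℝ) / 3) := by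
    rw [show (-(1 : ℝ) / 3) = -(1 / 3) by norm_num, Real.rpow_neg hx0, div_inv_eq_mul]
  have hroot : (4 * Real.pi * ρe / 3) ^ ((1 : ℝ) / 3) ≤ q := by
    have h1 : (4 * Real.pi * ρe / 3) ^ ((1 : ℝ) / 3) ≤ (q ^ 3) ^ ((1 : ℝ) / 3) := by
      refine Real.rpow_le_rpow hx0 ?_ (by norm_num)
      have h' : ρ_F ≤ 3 * q ^ 3 / (4 * Real.pi) := min_le_right _ _
      rw [le_div_iff₀ (by positivity)] at h'
      nlinarith [hρe_le.trans hρ_le, Real.pi_pos]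
    have h2 : (q ^ 3) ^ ((1 : ℝ) / 3) = q := by
      rw [show ((1 : ℝ) / 3) = ((3 : ℕ) : ℝ)⁻¹ by norm_num,
        Real.pow_rpow_inv_natCast hq0.le three_ne_zero]
    exact h1.trans_eq h2
  have haq : a * q ≤ c := by
    rw [hq, mul_div_assoc', div_le_iff₀ (by positivity)]
    nlinarith [hc, ha0]
  have hab_c : a / (4 * Real.pi * ρe / 3) ^ (-(1 : ℝ) / 3) ≤ c := by
    rw [hab_eq]
    exact (mul_le_mul_of_nonneg_left hroot ha0).trans haq
  -- (iii) Dyson's bound and `ρ₁ ≤ ρ̄`, `1 + C a/b ≤ 1 + Cc`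
  refine (hU hab_c).trans (ENNReal.ofReal_le_ofReal ?_)
  have h0C : 0 ≤ 1 + C * (a / (4 * Real.pi * ρe / 3) ^ (-(1 : ℝ) / 3)) := by
    rw [hab_eq]; positivity
  have h1C : 1 + C * (a / (4 * Real.pi * ρe / 3) ^ (-(1 : ℝ) / 3)) ≤ 1 + C * c := by
    nlinarith [hab_c, hC]
  calc 4 * Real.pi * ρe * a * (1 + C * (a / (4 * Real.pi * ρe / 3) ^ (-(1 : ℝ) / 3))) *
        ((m + 1 : ℕ) : ℝ)
      ≤ 4 * Real.pi * (((m + 1 : ℕ) : ℝ) / L ^ 3) * a * (1 + C * c) * ((m + 1 : ℕ) : ℝ) := by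
        gcongr
    _ = 4 * Real.pi * (1 + C * c) * (((m + 1 : ℕ) : ℝ) / L ^ 3) * a * ((m + 1 : ℕ) : ℝ) := by ring

/-! ### The registered stub -/

/-- **Registered stub `stub_kineticBudget` — THE KINETIC BUDGET** `KineticBudgetExists`: for
repulsive finite-range (bounded) `v` there are `C_F ≥ 0`, `ρ_F > 0`, `N_F = 2` such that every
exact zero-free minimiser at density `≤ ρ_F` with `N ≥ N_F` has `T(Φ) ≤ C_F ρ̄ a N` and
`∫W|∇₀ψ|² ≤ C_F ρ̄ a`: `T ≤ periodicEnergy v Φ = E₀` ((H1)), Dyson's bound in the dilute window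
(`kb_exists_energy_budget`), and `N·∫W|∇₀ψ|² ≤ T` (`kb_succ_mul_fibreFisher_le`). The boundedness
hypothesis is not needed. [folklore] -/
theorem stub_kineticBudget : Goal.stub_kineticBudget := by
  intro v hv _hB
  obtain ⟨C_F, ρ_F, hCF, hρF, H⟩ := kb_exists_energy_budget v hv
  refine ⟨C_F, ρ_F, hCF, hρF, 2, fun m hm L hL hρ Φ hE hΦ => ?_⟩
  have hT : (∫⁻ X in cellN (m + 1) L, kineticDensity Φ.ψ X) ≤ ENNReal.ofReal
      (C_F * (((m + 1 : ℕ) : ℝ) / L ^ 3) * (scatteringLength v).toReal * (m + 1 : ℕ)) :=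
    calc (∫⁻ X in cellN (m + 1) L, kineticDensity Φ.ψ X) ≤ periodicEnergy v Φ :=
          lintegral_mono fun _ => le_self_add
      _ = periodicGroundStateEnergy v (m + 1) L := hE
      _ ≤ _ := H m hm L hL hρ
  refine ⟨hT, ?_⟩
  have hN0 : ((m + 1 : ℕ) : ℝ≥0∞) ≠ 0 := by exact_mod_cast Nat.succ_ne_zero m
  rw [← ENNReal.mul_le_mul_iff_right hN0 (ENNReal.natCast_ne_top _)]
  calc ((m + 1 : ℕ) : ℝ≥0∞) * fibreFisher Φ ≤ ∫⁻ X in cellN (m + 1) L, kineticDensity Φ.ψ X :=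
        kb_succ_mul_fibreFisher_le hL Φ hΦ
    _ ≤ _ := hT
    _ = ((m + 1 : ℕ) : ℝ≥0∞) *
          ENNReal.ofReal (C_F * (((m + 1 : ℕ) : ℝ) / L ^ 3) * (scatteringLength v).toReal) := by
        rw [ENNReal.ofReal_mul' (Nat.cast_nonneg _), ENNReal.ofReal_natCast, mul_comm]

end Summit.AtomisticToContinuum.BoseEinsteinCondensation.Cruxes.FibreConductance.HealingSplitKineticDefect

end
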